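/- Copyright: the b2b-balaban cell (near-miss cell 7), T⁴-continuum fan-out; row NE7b ROUND-2 swarm, seat
t4-ne7b-formalise-leaf-06 (gen 7) (road W-RP, sub-row «W-LAB», file 2: the labelled reading on the cube tower; the END
over the `SU(n)` Gibbs cube towers; INTENT journal l.17482).  Released under the licence of the surrounding project. -/
import Summits.QuantumFields.BalabanUV.T4Continuum.Support.HistoryChessboardLabels
import Summits.QuantumFields.BalabanUV.T4Continuum.Support.HistoryRPTowerColumnCubes

/-!
# Road W-RP, sub-row «W-LAB», file 2: LABELLED EVENTS ON THE CUBE TOWER — `E_meas`∕`loc` from the cube column, the END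

Summits-side support leaf of the T⁴-continuum cell (rung (B)+1 on a FINITE torus only; NOT infinite volume, NOT the
mass gap, NOT the Clay statement; NOT a proof of the spine estimate NE7b).  Row NE7b, road **W-RP** (R-OWNER-23-2 ∕
R-OWNER-23-8), sub-row «W-LAB», file 2, on top of file 1 (`HistoryChessboardLabels`: `LabelSide`, `LabelSide.eventSide`),
this lineage's file 4c (`HistoryChessboardEventsCubes`: the cube torus `cubeRefl`∕`cubePos`, the END
`hybridNE7_of_towerEventSidesCubes_SU`) and W3n file 3 (`HistoryRPTowerColumnCubes`, leaf-07 g5: `E_meas_of_cubeColumn`,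
`loc_of_cubeColumn`).  [folklore] bookkeeping over TREE theorems; ONE hypothesis SHAPE `structure CubeLabelSide … : Prop`
(consumed only as a binder); no definition of data, no `[cite:]` tag, no `Prop`-valued FACT minted (c1), no constant
(c2∕c6), no exit ∕ socket ∕ `HistoryConstants` file touched (c3).

WHAT.
* §1 (the cube tower: `h : P.sitesPerDir K = M·N`, `θ := cubeRefl h`, `mP := cubePos G h`): `structure CubeLabelSide` =
  file 1's `LabelSide` with `lab_meas`∕`loc` REPLACED by `col` (the bad-label event of a cube reads only that cube's
  column algebra `colAlg G K (cubeSites M c)`), and **`CubeLabelSide.labelSide (hK : K ≤ m + K_P)`** by W3n-3's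
  `E_meas_of_cubeColumn`∕`loc_of_cubeColumn` BY NAME; `CubeLabelSide.eventSide`; the partition BY NAME
  (`CubeLabelSide.ev_meas ∕ ev_cover ∕ ev_disj` — W-E1's `hmeas`∕`hcover`∕`hdisj` shapes).
* §2 the END **`hybridNE7_of_towerCubeLabelSides_SU`**: file 4c's `hybridNE7_of_towerEventSidesCubes_SU` from two
  families of `CubeLabelSide`s on the `SU(n)` Gibbs cube towers of the cutoff family (NO RP ∕ `Even` ∕ `prob` ∕ `E_meas` ∕
  `loc` ∕ `ev_cover` ∕ `bad_disj` ∕ `bad_sub` ∕ `sym` hypothesis; same weight `e^{2·ob·l₀}·#P·N^d·(r + r′)`).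
* §3 sanity: the constant labelling inhabits `CubeLabelSide` on the actual Gibbs cube tower IN SITU; 4a's `EventSide`
  and W4b′'s full 21-clause `CutoffReading` are recovered BY NAME (file 1, file 4c).

HONEST SCOPE (R-OWNER-23-8 wording for road W-RP).  Displayed for an instantiating seat of the END: per run and cutoff
the clauses of `CubeLabelSide` — WHICH term label and cube labelling (that Bałaban's large-field classes per cube ARE
such labels and his expansion terms such fibres: (EXT) proper), `repr`, `bad_lab`, `col`, `equiv`, `univ_le` ((U1)+(G2)),
bookkeeping — + NE7c `ShellWeightBound` + NE7 `ReindexedBudget` + the summable rates; the typing identification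
«`blockAvg ℰ` is (0.4)» is T-class; the torus scheme is the cell's own definition.  Nothing of H3 ∕ (B) ∕ BetaPertH
discharged; 0∕9 unchanged.  NE7b NOT proved; spine 0∕9.  HONEST DEPENDENCY (cell): continuum YM on T⁴ ⇐ BetaPertH ∧ nine
spine estimates (0/9 proved); BetaPertH ⇐ (D1) ∧ (D4) ∧ CAP+tail; G-an2-4 gates asym, D1 and NE2/3/4.  This file changes
none of it.
-/

open Finset MeasureTheory Literature.Barriers.CriticalPhenomena.NonGibbs Literature.Probability.LatticeModels
open Literature.MathematicalPhysics.QuantumFieldTheory.Balaban1983to89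
open T4IndicatorShell T4MatchingAssembly T4MatchingClosure
open Summit.QuantumFields.BalabanUV.T4Continuum HistoryChessboardAssembly HistoryChessboardEvents
open HistoryChessboardEventsCutoff HistoryChessboardEventsSplit HistoryChessboardEventsTower HistoryChessboardEventsCubes
open HistoryChessboardEventsCubeSites HistoryRPTowerLaw HistoryRPTowerCuts HistoryRPTowerColumnSigma
open HistoryRPTowerColumnCubes HistoryChessboardLabels BlockAveraging

namespace Summit.QuantumFields.BalabanUV.T4Continuum.HistoryChessboardLabelsCubes

noncomputable section

/-! ## §1 The labelled reading on the cube tower: `E_meas` and `loc` from W3n file 3 -/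

section Cube

variable {P : Params} {G : Type*} [GaugeGroup G] [MeasurableSpace G] {M N K : ℕ} {ι Λ : Type*}

/-- **THE LABELLED READING ON THE CUBE TORUS OF THE TOWER** `Tower P G K` (cells = cubes of side `M` of the top lattice,
`h : sitesPerDir K = M·N`; reflections `cubeRefl h`, positive algebras `cubePos G h` — file 4c): file 1's `LabelSide` with
the two measurability clauses `lab_meas`∕`loc` REPLACED by `col` — the bad-label event of a cube reads only the variables
of that cube's column (`colAlg G K (cubeSites M c)`, W3n files 2–3).  A hypothesis SHAPE; NOTHING of Bałaban's is
asserted; no citation tag. [folklore] -/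
structure CubeLabelSide [NeZero N] (h : P.sitesPerDir K = M * N) (Pat : Finset Λ) (T : Finset ι) (A : ℝ → ι → ℝ)
    (Bad : Finset ι) (μ : Measure (Tower P G K)) (Z : ℝ) (term : Tower P G K → ι) (obs : Tower P G K → ℝ) (ob : ℝ)
    (lab : Tower P G K → BlockIdx P.d N → Λ) (r : ℝ) : Prop where
  /-- the undressed partition function is positive -/
  Z_pos : 0 < Z
  /-- the bad class consists of terms -/
  bad_subset : Bad ⊆ T
  /-- every state belongs to a term of `T` -/
  range : ∀ ω, term ω ∈ T
  /-- term events are measurable -/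
  term_meas : ∀ τ ∈ T, MeasurableSet (term ⁻¹' {τ})
  /-- the source observable is measurable … -/
  obs_meas : Measurable obs
  /-- … and bounded by `ob` -/
  obs_bdd : ∀ ω, |obs ω| ≤ ob
  /-- the bound is nonnegative -/
  ob_nonneg : 0 ≤ ob
  /-- (EXT)+(DRESS): the dressed weight of a term is the source-dressed mass of its fibre -/
  repr : ∀ (t : ℝ), ∀ τ ∈ T, A t τ = Z * ∫ ω in term ⁻¹' {τ}, Real.exp (t * obs ω) ∂μ
  /-- (EXT)∘(LOC), pointwise: a state in a bad term carries a bad label in some cube -/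
  bad_lab : ∀ ω, term ω ∈ Bad → ∃ c, lab ω c ∈ Pat
  /-- (LOC): the bad-label event of a cube is an event of that cube's column algebra -/
  col : ∀ l ∈ Pat, ∀ c : BlockIdx P.d N, MeasurableSet[colAlg G K (cubeSites (K := K) M c)] {ω | lab ω c = l}
  /-- (R-sym), pointwise: the labelling is equivariant under the cube reflections -/
  equiv : ∀ (i : Fin P.d) (k : ZMod N) (c : BlockIdx P.d N) (ω : Tower P G K),
    lab (cubeRefl (G := G) h i k ω) c = lab ω (cellReflect i k c)
  /-- (U1)+(G2), ratio currency: the pattern «every cube carries the bad label `l`» has probability `≤ r^(N^d)` -/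
  univ_le : ∀ l ∈ Pat, μ.real {ω | ∀ c, lab ω c = l} ≤ r ^ (N ^ P.d)
  /-- the per-cell rate is nonnegative -/
  r_nonneg : 0 ≤ r

variable [NeZero N] {h : P.sitesPerDir K = M * N} {Pat : Finset Λ} {T : Finset ι} {A : ℝ → ι → ℝ} {Bad : Finset ι}
  {μ : Measure (Tower P G K)} {Z : ℝ} {term : Tower P G K → ι} {obs : Tower P G K → ℝ} {ob : ℝ}
  {lab : Tower P G K → BlockIdx P.d N → Λ} {r : ℝ}

/-- **THE CUBE-COLUMN LABELLED READING IS A LABELLED READING** relative to `cubeRefl h` ∕ `cubePos G h` (`K ≤ m + K_P`):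
`lab_meas` and `loc` by W3n file 3's `E_meas_of_cubeColumn` ∕ `loc_of_cubeColumn` BY NAME. [folklore] -/
theorem CubeLabelSide.labelSide (H : CubeLabelSide h Pat T A Bad μ Z term obs ob lab r) (hK : K ≤ P.m + P.K) :
    LabelSide P.d N Pat T A Bad μ Z term obs ob lab (cubeRefl h) (cubePos G h) r where
  Z_pos := H.Z_pos
  bad_subset := H.bad_subset
  range := H.range
  term_meas := H.term_meas
  lab_meas := E_meas_of_cubeColumn G (E := fun l c => {ω | lab ω c = l}) H.col
  obs_meas := H.obs_meas
  obs_bdd := H.obs_bdd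
  ob_nonneg := H.ob_nonneg
  repr := H.repr
  bad_lab := H.bad_lab
  loc := loc_of_cubeColumn G (E := fun l c => {ω | lab ω c = l}) hK h H.col
  equiv := H.equiv
  univ_le := H.univ_le
  r_nonneg := H.r_nonneg

/-- … hence 4a's event half over the cube torus (`K ≤ m + K_P`). [folklore] -/
theorem CubeLabelSide.eventSide (H : CubeLabelSide h Pat T A Bad μ Z term obs ob lab r) (hK : K ≤ P.m + P.K) :
    EventSide P.d N Pat T A Bad μ Z (fun τ => term ⁻¹' {τ}) obs ob (fun l c => {ω | lab ω c = l}) (cubeRefl h)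
      (cubePos G h) r :=
  (H.labelSide hK).eventSide

/-- the term events are measurable (W-E1's `hmeas` shape). [folklore] -/
theorem CubeLabelSide.ev_meas (H : CubeLabelSide h Pat T A Bad μ Z term obs ob lab r) :
    ∀ τ ∈ T, MeasurableSet (term ⁻¹' {τ}) :=
  H.term_meas

/-- the term events cover (W-E1's `hcover` shape). [folklore] -/
theorem CubeLabelSide.ev_cover (H : CubeLabelSide h Pat T A Bad μ Z term obs ob lab r) :
    Set.univ ⊆ ⋃ τ ∈ T, term ⁻¹' {τ} :=
  cover_fibre H.range

/-- all term events are pairwise disjoint (W-E1's `hdisj` shape). [folklore] -/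
theorem CubeLabelSide.ev_disj (_H : CubeLabelSide h Pat T A Bad μ Z term obs ob lab r) :
    (↑T : Set ι).PairwiseDisjoint fun τ => term ⁻¹' {τ} :=
  Set.pairwiseDisjoint_fiber term _

end Cube

/-! ## §2 The END over the `SU(n)` Gibbs cube towers from two families of labelled readings -/

section Family

variable {n : ℕ} [NeZero n] {ι Λ : Type*} [DecidableEq ι] {Pat : Finset Λ} {T : ℕ → Finset ι} {K₀ : ℕ}
  {A B shA shB Cc Rr CcRec RrRec : ℕ → ℝ → ι → ℝ} {Bad : ℕ → Finset ι} {Z Z' : ℕ → ℝ}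
  {r r' ν u s₂ c₀ rr s Wsh : ℕ → ℝ} {l₀ vol : ℝ}

/-- **THE ROAD'S END OVER THE `SU(n)` GIBBS CUBE TOWERS FROM TWO FAMILIES OF LABELLED READINGS** (node U5, seam (ζ′)):
run A = the towers over `cutoffParams P₀ K` (couplings `βA K ≥ 0`, averagings `ℰA K k`) read by term labels `term K`
and cube labellings `lab K`, run B likewise; cells = the `N := 2·L^{m−m₁}` cubes of side `L^{m₁}` per direction; at
every cutoff `K ≥ K₀` ONLY THE LABELLED READINGS are hypotheses — `prob`, the RP half, `Even N` (file 4c), `E_meas`∕`loc`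
(W3n file 3), `ev_cover`∕`bad_disj`∕`bad_sub`∕`sym` (file 1) are PRODUCED; then file 4c's
`hybridNE7_of_towerEventSidesCubes_SU` verbatim.  Nothing PRINTED is asserted; NE7b is NOT proved by this. [folklore] -/
theorem hybridNE7_of_towerCubeLabelSides_SU (P₀ : Params) {m₁ : ℕ} (hm₁ : m₁ ≤ P₀.m) {βA βB : ℕ → ℝ}
    (hβA : ∀ K, 0 ≤ βA K) (hβB : ∀ K, 0 ≤ βB K) (ℰA ℰB : ℕ → ℕ → LoopAverage (Matrix.specialUnitaryGroup (Fin n) ℂ))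
    (hEA : ∀ K k l, Measurable fun W : Fin (l + 1) → Matrix.specialUnitaryGroup (Fin n) ℂ => (ℰA K k).E W)
    (hEB : ∀ K k l, Measurable fun W : Fin (l + 1) → Matrix.specialUnitaryGroup (Fin n) ℂ => (ℰB K k).E W)
    {term : ∀ K, Tower (cutoffParams P₀ K) (Matrix.specialUnitaryGroup (Fin n) ℂ) K → ι}
    {obs : ∀ K, Tower (cutoffParams P₀ K) (Matrix.specialUnitaryGroup (Fin n) ℂ) K → ℝ} {ob : ℝ}
    {lab : ∀ K, Tower (cutoffParams P₀ K) (Matrix.specialUnitaryGroup (Fin n) ℂ) K →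
      BlockIdx P₀.d (2 * P₀.L ^ (P₀.m - m₁)) → Λ}
    {term' : ∀ K, Tower (cutoffParams P₀ K) (Matrix.specialUnitaryGroup (Fin n) ℂ) K → ι}
    {obs' : ∀ K, Tower (cutoffParams P₀ K) (Matrix.specialUnitaryGroup (Fin n) ℂ) K → ℝ}
    {lab' : ∀ K, Tower (cutoffParams P₀ K) (Matrix.specialUnitaryGroup (Fin n) ℂ) K →
      BlockIdx P₀.d (2 * P₀.L ^ (P₀.m - m₁)) → Λ}
    (HA : ∀ K, K₀ ≤ K → CubeLabelSide (sitesPerDir_cutoffParams_self_eq_mul P₀ hm₁ K) Pat (T K) (A K) (Bad K)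
      (towerLaw (T4GenFunBounds.gibbsMeasure (G := Matrix.specialUnitaryGroup (Fin n) ℂ) (cutoffParams P₀ K) (βA K))
        (fun k => blockAvg (P := cutoffParams P₀ K) (j := k) (ℰA K k)) K)
      (Z K) (term K) (obs K) ob (lab K) (r K))
    (HB : ∀ K, K₀ ≤ K → CubeLabelSide (sitesPerDir_cutoffParams_self_eq_mul P₀ hm₁ K) Pat (T K) (B K) (Bad K)
      (towerLaw (T4GenFunBounds.gibbsMeasure (G := Matrix.specialUnitaryGroup (Fin n) ℂ) (cutoffParams P₀ K) (βB K))
        (fun k => blockAvg (P := cutoffParams P₀ K) (j := k) (ℰB K k)) K)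
      (Z' K) (term' K) (obs' K) ob (lab' K) (r' K))
    (hr : Summable r) (hr' : Summable r')
    (hSh : ShellWeightBound l₀ T A B shA shB Wsh)
    (hTB : ReindexedBudget l₀ vol T (fun K t τ => A K t τ - shA K t τ) (fun K t τ => B K t τ - shB K t τ)
      (fun K _ => Bad K) Cc Rr CcRec RrRec ν u s₂ c₀ rr s)
    (hrr : Summable rr) (hu : Summable u) (hs : Summable s) (hs₂ : Summable s₂) :
    ∃ K₁ K₂, K₀ ≤ K₁ ∧ HybridNE7 l₀ vol (fun K => T (K₁ + (K₂ + K))) (fun K => A (K₁ + (K₂ + K)))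
      (fun K => B (K₁ + (K₂ + K))) (fun K _ => Bad (K₁ + (K₂ + K)))
      (fun K => Real.exp (2 * (ob * l₀)) *
        ((#Pat : ℝ) * ((2 * P₀.L ^ (P₀.m - m₁) : ℕ) : ℝ) ^ P₀.d * (r (K₁ + (K₂ + K)) + r' (K₁ + (K₂ + K)))))
      (fun K => shA (K₁ + (K₂ + K))) (fun K => shB (K₁ + (K₂ + K))) (fun K => Wsh (K₁ + (K₂ + K)))
      (fun K => (rr (K₁ + (K₂ + K)) + u (K₁ + (K₂ + K))) + (s (K₁ + (K₂ + K)) + s₂ (K₁ + (K₂ + K)))) :=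
  hybridNE7_of_towerEventSidesCubes_SU P₀ hm₁ hβA hβB ℰA ℰB hEA hEB
    (fun K hK => (HA K hK).eventSide (le_m_add_K_cutoffParams P₀ K))
    (fun K hK => (HB K hK).eventSide (le_m_add_K_cutoffParams P₀ K))
    hr hr' hSh hTB hrr hu hs hs₂

end Family

/-! ## §3 Sanity: the labelled reading is inhabited IN SITU; 4a's event half and W4b′'s reading recovered BY NAME -/

namespace Sanity

variable {n : ℕ} [NeZero n]

/-- NON-VACUITY IN SITU: on the ACTUAL carrier `Tower P SU(n) K` with the ACTUAL Gibbs tower law of Bałaban's block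
averagings and cube cells (`sitesPerDir K = M·N`), the labelled reading is INHABITED by the constant labelling (one term,
one label, no bad label, no bad term, source `0`, `Z = 1`, rate `1`). [folklore] -/
theorem cubeLabelSide_trivial (P : Params) {β : ℝ} (hβ : 0 ≤ β)
    (ℰ : ℕ → LoopAverage (Matrix.specialUnitaryGroup (Fin n) ℂ))
    (hE : ∀ k l, Measurable fun W : Fin (l + 1) → Matrix.specialUnitaryGroup (Fin n) ℂ => (ℰ k).E W)
    {M N K : ℕ} [NeZero N] (h : P.sitesPerDir K = M * N) :
    CubeLabelSide (G := Matrix.specialUnitaryGroup (Fin n) ℂ) h (∅ : Finset Unit) ({()} : Finset Unit)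
      (fun _ _ => (1 : ℝ)) (∅ : Finset Unit)
      (towerLaw (T4GenFunBounds.gibbsMeasure (G := Matrix.specialUnitaryGroup (Fin n) ℂ) P β)
        (fun k => blockAvg (P := P) (j := k) (ℰ k)) K)
      1 (fun _ => ()) (fun _ => 0) 0 (fun _ _ => ()) 1 := by
  haveI := T4GenFunBounds.isProbabilityMeasure_gibbsMeasure (G := Matrix.specialUnitaryGroup (Fin n) ℂ) P hβ
  haveI := isProbabilityMeasure_towerLaw (P := P) (av := fun k => blockAvg (P := P) (j := k) (ℰ k))
    (fun k => measurable_avgFun (ℰ k) (hE k))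
    (T4GenFunBounds.gibbsMeasure (G := Matrix.specialUnitaryGroup (Fin n) ℂ) P β) K
  have huniv : (fun _ : Tower P (Matrix.specialUnitaryGroup (Fin n) ℂ) K => ()) ⁻¹' {()} = Set.univ :=
    Set.preimage_const_of_mem rfl
  exact
  { Z_pos := one_pos
    bad_subset := Finset.empty_subset _
    range := fun _ => Finset.mem_singleton_self _
    term_meas := fun _ _ => by rw [huniv]; exact MeasurableSet.univ
    obs_meas := measurable_const
    obs_bdd := fun _ => by simp
    ob_nonneg := le_rfl
    repr := fun t τ _ => by rw [huniv]; simp [Measure.restrict_univ]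
    bad_lab := fun _ hτ => by simp at hτ
    col := fun _ hl => by simp at hl
    equiv := fun _ _ _ _ => rfl
    univ_le := fun _ hl => by simp at hl
    r_nonneg := zero_le_one }

/-- … hence 4a's event half on the cube torus, and — by file 4c — W4b′'s full 21-clause `CutoffReading`, for the fibre
events of the constant labelling (`K ≤ m + K_P`). -/
example (P : Params) {β : ℝ} (hβ : 0 ≤ β) (ℰ : ℕ → LoopAverage (Matrix.specialUnitaryGroup (Fin n) ℂ))
    (hE : ∀ k l, Measurable fun W : Fin (l + 1) → Matrix.specialUnitaryGroup (Fin n) ℂ => (ℰ k).E W)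
    {M N K : ℕ} [NeZero N] (h : P.sitesPerDir K = M * N) (hK : K ≤ P.m + P.K) :
    CutoffReading P.d N (∅ : Finset Unit) ({()} : Finset Unit) (fun _ _ => (1 : ℝ)) (∅ : Finset Unit)
      (towerLaw (T4GenFunBounds.gibbsMeasure (G := Matrix.specialUnitaryGroup (Fin n) ℂ) P β)
        (fun k => blockAvg (P := P) (j := k) (ℰ k)) K)
      1 (fun τ => (fun _ => ()) ⁻¹' {τ}) (fun _ => 0) 0 (fun l c => {ω | (fun _ _ => ()) ω c = l})
      (cubeRefl h) (cubePos (Matrix.specialUnitaryGroup (Fin n) ℂ) h) 1 :=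
  ((cubeLabelSide_trivial P hβ ℰ hE h).eventSide hK).cutoffReading_towerLaw_gibbs_SU_cubes P hβ ℰ hE hK h

end Sanity

end

end Summit.QuantumFields.BalabanUV.T4Continuum.HistoryChessboardLabelsCubes
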